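import Summits.QuantumFields.BalabanUV.Beta.FP.PeriodisedFormGaugeLegTwo

/-!
# `BalabanUV.Beta.FP.PeriodisedWardOrderTwoWilson` — road «FP» (binder row D1), ROUTE T, the (J-a) dictionary's ORDER-TWO Ward row `a2` at level 0,
# **WILSON SECTOR, IN CLOSED FORM: `torus_a2_wilson`** (file (R4b) = part 2 of `PeriodisedFormGaugeLegTwo`; the order-2 twin of this lineage's O-2
# `PeriodisedFormGaugeLeg.torus_a1_wilson`)

HONEST DEPENDENCY (page 1, mandatory): continuum YM on T⁴ ⇐ BetaPertH ∧ nine spine estimates (0/9 proved); BetaPertH ⇐ (D1) ∧ (D4) ∧ CAP+tail;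
G-an2-4 gates asym, D1 and NE2/3/4.  HONEST FRAMING (cell contract, verbatim): «discharging `BetaPertH` makes Bałaban's UV stability UNCONDITIONAL —
a real constructive-QFT result; it is NOT the continuum limit and NOT the Clay problem.»  ABSOLUTE RULE (cell charter, verbatim): «No internally-minted
statement may enter as a cited fact. Every hypothesis is either kernel-proved in this package or a verbatim quotation of a PUBLISHED theorem with page
reference. The manuscript(s) under audit are NOT citable for their own disputed steps — they are the thing under adjudication; programme-internal
(2001/route/tribunal) claims are never citable.»

WHAT ([folklore] finite sums BY NAME; no `def`, no `def … : Prop`, nothing cited, 0 sorry):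
* §3 part 1's torus law against the two gauge-mode families of the torus call — fine modes `tgrad` (`sum_perZ_dper_wilsonT2per_mul_tgrad`) and block-constant
  modes `tgradBlock` on `fine Lc M′` (`sum_perZ_dper_wilsonT2per_mul_tgradBlock`) (O-2 §3 pattern).
* §4 **`torus_a2_wilson`** — with U21's (`NestedStepLawTorusTransportedRowsGradedLevelZeroSymULowClosedLamW2Q2.torus_nested_step_law_level0_d3`) binders
  `hH₀ hD₁ hD₂ hW₁ hW₂` and an2's `hW` VERBATIM up to the generic letters `d`, `c := (Lc^{d+1}·stepScale d Lc 0)⁻¹`, `g₁ g₂` (column selections), the Wilson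
  parts `H₁ʷ := (−2c) • Σ_b h b • perF F (dper F (wilsonA d b))|ff` of `hH₁` and `H₂ʷ := (−2c)² • Σ_b Σ_b′ (h b·h b′) • perF F (dper F (W b′ b))|ff` of `hH₂`
  (`G := 0`, no Λ-companion), `2 ≤ N`:
  `H₂ʷ * fromCols D₂ D₁ + 2 • (H₁ʷ * W₁) + H₀ * W₂ = c² • of (v e ↦ h v · (H₀ *ᵥ h) v · σ_e(v.1 + e_{v.2}))` —
  the `−½` end-of-bond readings of the bi-member ARE `−2 • (H₁ʷ * W₁)`, its `−¼` diagonal contact IS `−H₀ * W₂`, the `⅛` first-leg contact survives: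
  DIAGONAL in the fluctuation bond, read at its tip, proportional to the linearised-KKT residual `H₀ h` — `𝔔₀ᵀ·Y₂`-shaped for no `Y₂` in general, exactly
  like `a1`'s Wilson sector (O-2): the door's `a2` at level 0 needs the SAME companion mechanism as `a1` (U21's `E`∕`E′` slots), nothing new.
Discharges NO binder of row D1 and NO row of the door by itself (it computes the Wilson sector of U21's `a2` left side; `a2` also carries `G` and the
Λ-companions); 0 estimates; 0∕4 row-D1 binders (hW, hR, D1Tel, D1Rep); NOT (J-a) complete, NOT (T-ID), NOT SDF, NOT D1, NEVER «G-an2-4 closed», NOT BetaPertH,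
NOT continuum, NOT Clay.  «not in print; our bookkeeping».
Unit `b2b-balaban-beta-d1-formalise-leaf-05` (gen 35), 2026-08-23; no existing file touched.
-/

noncomputable section

namespace Summit.QuantumFields.BalabanUV.Beta.FP.PeriodisedWardOrderTwoWilson

open scoped BigOperators
open Finset
open Literature.MathematicalPhysics.QuantumFieldTheory.Balaban1983to89
open Literature.MathematicalPhysics.QuantumFieldTheory.Balaban1983to89.Beta
open B4TorusKernel.MultiPeriod (translate translate_apply)
open B6Lemma24Torus (pbox mem_pbox)
open ExpKernelCalculus (MKer)
open AffineAveraging (Site unitVec)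
open OneStepResolventKernel (Fib)
open StepJetData (wilsonA)
open WilsonBiStencil (wilsonW₂)
open WilsonVertex2Sym (wsym22)
open Summit.QuantumFields.BalabanUV.Beta.FP.KernelPeriodisationFib (Idx perF perF_apply perZ)
open Summit.QuantumFields.BalabanUV.Beta.FP.KernelPeriodisationFibLoc (dper)
open Summit.QuantumFields.BalabanUV.Beta.BorderedHessian (bhKStepAt)
open Summit.QuantumFields.BalabanUV.Beta.FP.TorusGaugeCovariance (tdelta tdelta_translate tgrad tgrad_inl)
open Literature.MathematicalPhysics.QuantumFieldTheory.LatticeForm (quo)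
open Summit.QuantumFields.BalabanUV.Beta.FP.TorusGaugeCovarianceCoarse (tgradBlock tgradBlock_inl tdelta_quo_congr)
open B5Prop11Plancherel (fine)
open Summit.QuantumFields.BalabanUV.Beta.FP.PeriodisedFormGaugeLegTwo (sum_perZ_dper_wilsonT2per_mul_grad_periodic)

variable {d : ℕ} {N : ℕ}

/-! ## §3 Part 1's torus law against the two gauge-mode families of the torus call (O-2 §3 pattern): fine modes `tgrad` and block-constant modes
`tgradBlock` on `fine Lc M′` -/

section Columns

variable (M : Fin (d + 1) → ℕ) [∀ μ, NeZero (M μ)]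

/-- [folklore] **`sum_perZ_dper_wilsonT2per_mul_tgrad`** — §2 against a FINE gauge-mode column `s` of `tgrad M`. -/
theorem sum_perZ_dper_wilsonT2per_mul_tgrad (hN : 2 ≤ N) (κ' : Fin (d + 1)) {u' : Site (d + 1)} (hu' : u' ∈ pbox M)
    {V : Fin (d + 1) → Site (d + 1) → MKer (d + 1) (Fib d)}
    (hV : V = fun κ u x z a c => ∑' n : Site (d + 1), wilsonW₂ d ((8 * (N : ℝ) ^ 2)⁻¹ • wsym22 N) κ u κ' (translate M u' n) x z a c)
    (ρ : Site (d + 1)) (L : ℕ) [NeZero L] (κ : Fin (d + 1)) {u : Site (d + 1)} (hu : u ∈ pbox M) {x : Site (d + 1)} (hx : x ∈ pbox M)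
    (α : Fin (d + 1)) (s : ↥(pbox M)) :
    ∑ y : ↥(pbox M), ∑ β : Fin (d + 1), perZ M (dper M (V κ u)) x (y : Site (d + 1)) (Sum.inl α) (Sum.inl β) * tgrad M (y, Sum.inl β) s =
      -(1 / 2 : ℝ) * (tdelta M (u' + unitVec κ') s * perZ M (dper M (wilsonA d κ u)) x u' (Sum.inl α) (Sum.inl κ')
          + tdelta M (u + unitVec κ) s * perZ M (dper M (wilsonA d κ' u')) x u (Sum.inl α) (Sum.inl κ))
      - (1 / 4 : ℝ) * ((if u = u' ∧ κ = κ' then (1 : ℝ) else 0) * tdelta M (u + unitVec κ) s * perZ M (bhKStepAt d ρ L 0) x u (Sum.inl α) (Sum.inl κ))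
      + (1 / 8 : ℝ) * tdelta M (x + unitVec α) s
          * ((if x = u' ∧ α = κ' then (1 : ℝ) else 0) * perZ M (bhKStepAt d ρ L 0) x u (Sum.inl α) (Sum.inl κ)
            + (if x = u ∧ α = κ then (1 : ℝ) else 0) * perZ M (bhKStepAt d ρ L 0) x u' (Sum.inl α) (Sum.inl κ')) := by
  have h := sum_perZ_dper_wilsonT2per_mul_grad_periodic M hN κ' hu' hV ρ L κ hu hx α (φ := fun z => tdelta M z s) (fun z m => tdelta_translate M z m s)
  simpa only [tgrad_inl] using h

/-- [folklore] **`sum_perZ_dper_wilsonT2per_mul_tgradBlock`** — §2 on the fine box `fine Lc M′` against a BLOCK-CONSTANT gauge-mode column `t` of `tgradBlock M′ Lc`. -/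
theorem sum_perZ_dper_wilsonT2per_mul_tgradBlock (M' : Fin (d + 1) → ℕ) [∀ μ, NeZero (M' μ)] (Lc : ℕ) [NeZero Lc] (hN : 2 ≤ N)
    (κ' : Fin (d + 1)) {u' : Site (d + 1)} (hu' : u' ∈ pbox (fine Lc M'))
    {V : Fin (d + 1) → Site (d + 1) → MKer (d + 1) (Fib d)}
    (hV : V = fun κ u x z a c => ∑' n : Site (d + 1), wilsonW₂ d ((8 * (N : ℝ) ^ 2)⁻¹ • wsym22 N) κ u κ' (translate (fine Lc M') u' n) x z a c)
    (ρ : Site (d + 1)) (L : ℕ) [NeZero L] (κ : Fin (d + 1)) {u : Site (d + 1)} (hu : u ∈ pbox (fine Lc M')) {x : Site (d + 1)}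
    (hx : x ∈ pbox (fine Lc M')) (α : Fin (d + 1)) (t : ↥(pbox M')) :
    ∑ y : ↥(pbox (fine Lc M')), ∑ β : Fin (d + 1),
        perZ (fine Lc M') (dper (fine Lc M') (V κ u)) x (y : Site (d + 1)) (Sum.inl α) (Sum.inl β) * tgradBlock M' Lc (y, Sum.inl β) t =
      -(1 / 2 : ℝ) * (tdelta M' (quo Lc (u' + unitVec κ')) t * perZ (fine Lc M') (dper (fine Lc M') (wilsonA d κ u)) x u' (Sum.inl α) (Sum.inl κ')
          + tdelta M' (quo Lc (u + unitVec κ)) t * perZ (fine Lc M') (dper (fine Lc M') (wilsonA d κ' u')) x u (Sum.inl α) (Sum.inl κ))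
      - (1 / 4 : ℝ) * ((if u = u' ∧ κ = κ' then (1 : ℝ) else 0) * tdelta M' (quo Lc (u + unitVec κ)) t
          * perZ (fine Lc M') (bhKStepAt d ρ L 0) x u (Sum.inl α) (Sum.inl κ))
      + (1 / 8 : ℝ) * tdelta M' (quo Lc (x + unitVec α)) t
          * ((if x = u' ∧ α = κ' then (1 : ℝ) else 0) * perZ (fine Lc M') (bhKStepAt d ρ L 0) x u (Sum.inl α) (Sum.inl κ)
            + (if x = u ∧ α = κ then (1 : ℝ) else 0) * perZ (fine Lc M') (bhKStepAt d ρ L 0) x u' (Sum.inl α) (Sum.inl κ')) := by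
  have hφ : ∀ z m : Site (d + 1), tdelta M' (quo Lc (translate (fine Lc M') z m)) t = tdelta M' (quo Lc z) t := fun z m => by
    refine tdelta_quo_congr M' Lc (fun i => ⟨m i, ?_⟩) t
    simp only [translate_apply, fine]
    push_cast
    ring
  have h := sum_perZ_dper_wilsonT2per_mul_grad_periodic (fine Lc M') hN κ' hu' hV ρ L κ hu hx α (φ := fun z => tdelta M' (quo Lc z) t) hφ
  simpa only [tgradBlock_inl] using h

end Columns

/-! ## §4 THE WILSON SECTOR OF THE LEVEL-0 DOOR's ORDER-TWO WARD ROW `a2` (U21's binders `hH₀ hD₁ hD₂ hW₁ hW₂ hW` with the column selections, the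
dimension `d` and the weight letter `c` generic, `G := 0`, no Λ-companion): the END-OF-BOND readings of `H₂ʷ·[D₂|D₁]` CANCEL `2•(H₁ʷ·W₁)` (first-order
members) and `H₀·W₂` (the diagonal contact), and what is left is DIAGONAL in the fluctuation bond, read at its TIP: `c² · h v · (H₀ h)_v · σ_e(v.1 + e_{v.2})`. -/

section DoorRow

/-- [folklore] the row algebra of `a2`'s Wilson sector, abstractly: with `A b b′` the first-order member of bond `b` read at `(v, b′)`, `P` the form row `H₀ v ·`,
`σ` the column's tip readings, the three products combine to `c²·h v·(Σ_b P b·h b)·σ v`. -/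
theorem a2_row_algebra {B : Type*} [Fintype B] [DecidableEq B] (c : ℝ) (h σ P : B → ℝ) (A : B → B → ℝ) (v : B) :
    (-2 * c) ^ 2 * (∑ b, ∑ b', h b * h b' *
        (-(1 / 2 : ℝ) * (σ b' * A b b' + σ b * A b' b) - (1 / 4 : ℝ) * ((if b = b' then (1 : ℝ) else 0) * σ b * P b)
          + (1 / 8 : ℝ) * σ v * ((if v = b' then (1 : ℝ) else 0) * P b + (if v = b then (1 : ℝ) else 0) * P b')))
      + 2 * (∑ b', ((-2 * c) * ∑ b, h b * A b b') * (h b' * (-c * σ b'))) + ∑ b, P b * ((c * h b) ^ 2 * σ b)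
      = c ^ 2 * (h v * (∑ b, P b * h b) * σ v) := by
  have e1 : ∑ b, ∑ b', h b * h b' * (σ b * A b' b) = ∑ b, ∑ b', h b * h b' * (σ b' * A b b') := by
    rw [Finset.sum_comm]
    exact Finset.sum_congr rfl fun b _ => Finset.sum_congr rfl fun b' _ => by ring
  have e2 : ∑ b, ∑ b', h b * h b' * ((if b = b' then (1 : ℝ) else 0) * σ b * P b) = ∑ b, h b * h b * (σ b * P b) := by
    refine Finset.sum_congr rfl fun b _ => ?_
    rw [Finset.sum_congr rfl fun b' _ => show h b * h b' * ((if b = b' then (1 : ℝ) else 0) * σ b * P b) = if b = b' then h b * h b' * (σ b * P b) else 0 by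
      split_ifs <;> ring, Finset.sum_ite_eq, if_pos (Finset.mem_univ _)]
  have e3 : ∑ b, ∑ b', h b * h b' * ((if v = b' then (1 : ℝ) else 0) * P b) = h v * ∑ b, P b * h b := by
    rw [Finset.mul_sum]
    refine Finset.sum_congr rfl fun b _ => ?_
    rw [Finset.sum_congr rfl fun b' _ => show h b * h b' * ((if v = b' then (1 : ℝ) else 0) * P b) = if v = b' then h b * h b' * P b else 0 by
      split_ifs <;> ring, Finset.sum_ite_eq, if_pos (Finset.mem_univ _)]
    ring
  have e4 : ∑ b, ∑ b', h b * h b' * ((if v = b then (1 : ℝ) else 0) * P b') = h v * ∑ b, P b * h b := by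
    rw [Finset.sum_comm, Finset.mul_sum]
    refine Finset.sum_congr rfl fun b' _ => ?_
    rw [Finset.sum_congr rfl fun b _ => show h b * h b' * ((if v = b then (1 : ℝ) else 0) * P b') = if v = b then h b * h b' * P b' else 0 by
      split_ifs <;> ring, Finset.sum_ite_eq, if_pos (Finset.mem_univ _)]
    ring
  have t1 : ∑ b', ((-2 * c) * ∑ b, h b * A b b') * (h b' * (-c * σ b')) = 2 * c ^ 2 * ∑ b, ∑ b', h b * h b' * (σ b' * A b b') := by
    calc ∑ b', ((-2 * c) * ∑ b, h b * A b b') * (h b' * (-c * σ b'))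
        = ∑ b', ∑ b, 2 * c ^ 2 * (h b * h b' * (σ b' * A b b')) := Finset.sum_congr rfl fun b' _ => by
          rw [Finset.mul_sum, Finset.sum_mul]
          exact Finset.sum_congr rfl fun b _ => by ring
      _ = 2 * c ^ 2 * ∑ b, ∑ b', h b * h b' * (σ b' * A b b') := by
          rw [Finset.sum_comm, Finset.mul_sum]
          exact Finset.sum_congr rfl fun b _ => by rw [Finset.mul_sum]
  have t2 : ∑ b, P b * ((c * h b) ^ 2 * σ b) = c ^ 2 * ∑ b, h b * h b * (σ b * P b) := by
    rw [Finset.mul_sum]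
    exact Finset.sum_congr rfl fun b _ => by ring
  rw [Finset.sum_congr rfl fun b _ => Finset.sum_congr rfl fun b' _ =>
    show h b * h b' * (-(1 / 2 : ℝ) * (σ b' * A b b' + σ b * A b' b) - (1 / 4 : ℝ) * ((if b = b' then (1 : ℝ) else 0) * σ b * P b)
          + (1 / 8 : ℝ) * σ v * ((if v = b' then (1 : ℝ) else 0) * P b + (if v = b then (1 : ℝ) else 0) * P b'))
      = (-(1 / 2 : ℝ)) * (h b * h b' * (σ b' * A b b')) + (-(1 / 2 : ℝ)) * (h b * h b' * (σ b * A b' b))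
        + (-(1 / 4 : ℝ)) * (h b * h b' * ((if b = b' then (1 : ℝ) else 0) * σ b * P b))
        + ((1 / 8 : ℝ) * σ v) * (h b * h b' * ((if v = b' then (1 : ℝ) else 0) * P b))
        + ((1 / 8 : ℝ) * σ v) * (h b * h b' * ((if v = b then (1 : ℝ) else 0) * P b')) by ring]
  simp only [Finset.sum_add_distrib, ← Finset.mul_sum]
  rw [e1, e2, e3, e4, t1, t2]
  ring

/-- **[folklore] `torus_a2_wilson` — THE WILSON SECTOR OF THE DOOR's `a2` ROW IN CLOSED FORM** (U21's `hH₀ hD₁ hD₂ hW₁ hW₂` and an2's `hW` VERBATIM up to the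
generic letters `d`, `c`, `g₁`, `g₂`; `2 ≤ N`): on the fine box `F = fine Lc M′`, for any bond weight `h`,
`H₂ʷ * fromCols D₂ D₁ + 2 • (H₁ʷ * W₁) + H₀ * W₂ = c² • of (v e ↦ h v · (H₀ *ᵥ h) v · σ_e(v.1 + e_{v.2}))`,
`H₁ʷ := (−2c) • Σ_b h b • perF F (dper F (wilsonA d b))|ff`, `H₂ʷ := (−2c)² • Σ_b Σ_b′ (h b·h b′) • perF F (dper F (W b′ b))|ff`, `σ_e` the column's potential
(`tdelta M′ (quo Lc ·) (g₂ t)` for block-constant columns, `tdelta F · (g₁ s)` for fine ones).  By §3 per pair of bonds: the `−½` end-of-bond readings of the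
bi-member are exactly `−2 • (H₁ʷ * W₁)`, its `−¼` diagonal contact is exactly `−H₀ * W₂`, and the `⅛` first-leg contact survives — DIAGONAL in the fluctuation
bond, proportional to the linearised-KKT residual `H₀ h` (so `a2`'s Wilson sector is `𝔔₀ᵀ·Y₂`-shaped for no `Y₂` in general, exactly like `a1`'s: O-2). -/
theorem torus_a2_wilson (M' : Fin (d + 1) → ℕ) [∀ μ, NeZero (M' μ)] (Lc : ℕ) [NeZero Lc] (ρ : Site (d + 1)) (L : ℕ) [NeZero L]
    {γ₁ γ₂ : Type*} [Fintype γ₁] [Fintype γ₂] (g₁ : γ₁ → ↥(pbox (fine Lc M'))) (g₂ : γ₂ → ↥(pbox M')) (c : ℝ)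
    (h : ↥(pbox (fine Lc M')) × Fin (d + 1) → ℝ)
    {H₀ : Matrix (↥(pbox (fine Lc M')) × Fin (d + 1)) (↥(pbox (fine Lc M')) × Fin (d + 1)) ℝ}
    (hH₀ : H₀ = (perF (fine Lc M') (bhKStepAt d ρ L 0)).submatrix
        (fun b : ↥(pbox (fine Lc M')) × Fin (d + 1) => ((b.1, Sum.inl b.2) : Idx (fine Lc M') (Fib d)))
        (fun b : ↥(pbox (fine Lc M')) × Fin (d + 1) => ((b.1, Sum.inl b.2) : Idx (fine Lc M') (Fib d))))
    {D₁ : Matrix (↥(pbox (fine Lc M')) × Fin (d + 1)) γ₁ ℝ}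
    (hD₁ : D₁ = (tgrad (fine Lc M')).submatrix (fun b : ↥(pbox (fine Lc M')) × Fin (d + 1) => ((b.1, Sum.inl b.2) : Idx (fine Lc M') (Fib d))) g₁)
    {D₂ : Matrix (↥(pbox (fine Lc M')) × Fin (d + 1)) γ₂ ℝ}
    (hD₂ : D₂ = (tgradBlock M' Lc).submatrix (fun b : ↥(pbox (fine Lc M')) × Fin (d + 1) => ((b.1, Sum.inl b.2) : Idx (fine Lc M') (Fib d))) g₂)
    {W₁ : Matrix (↥(pbox (fine Lc M')) × Fin (d + 1)) (γ₂ ⊕ γ₁) ℝ}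
    (hW₁ : W₁ = ∑ b : ↥(pbox (fine Lc M')) × Fin (d + 1), h b •
        Matrix.of (fun (b' : ↥(pbox (fine Lc M')) × Fin (d + 1)) (e : γ₂ ⊕ γ₁) =>
          if b' = b then
            -c * Sum.elim (fun t : γ₂ => tdelta M' (quo Lc ((b.1 : Site (d + 1)) + unitVec b.2)) (g₂ t))
                  (fun s : γ₁ => tdelta (fine Lc M') ((b.1 : Site (d + 1)) + unitVec b.2) (g₁ s)) e
          else 0))
    {W₂ : Matrix (↥(pbox (fine Lc M')) × Fin (d + 1)) (γ₂ ⊕ γ₁) ℝ}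
    (hW₂ : W₂ = Matrix.of fun (b : ↥(pbox (fine Lc M')) × Fin (d + 1)) (e : γ₂ ⊕ γ₁) =>
        (c * h b) ^ 2 * Sum.elim (fun t : γ₂ => tdelta M' (quo Lc ((b.1 : Site (d + 1)) + unitVec b.2)) (g₂ t))
          (fun s : γ₁ => tdelta (fine Lc M') ((b.1 : Site (d + 1)) + unitVec b.2) (g₁ s)) e)
    {H₁ : Matrix (↥(pbox (fine Lc M')) × Fin (d + 1)) (↥(pbox (fine Lc M')) × Fin (d + 1)) ℝ}
    (hH₁ : H₁ = ((-2 : ℝ) * c) • ∑ b : ↥(pbox (fine Lc M')) × Fin (d + 1), h b •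
        (perF (fine Lc M') (dper (fine Lc M') (wilsonA d b.2 (b.1 : Site (d + 1))))).submatrix
          (fun b : ↥(pbox (fine Lc M')) × Fin (d + 1) => ((b.1, Sum.inl b.2) : Idx (fine Lc M') (Fib d)))
          (fun b : ↥(pbox (fine Lc M')) × Fin (d + 1) => ((b.1, Sum.inl b.2) : Idx (fine Lc M') (Fib d))))
    {N : ℕ} (hN : 2 ≤ N)
    {W : Fin (d + 1) → Site (d + 1) → Fin (d + 1) → Site (d + 1) → MKer (d + 1) (Fib d)}
    (hW : W = fun κ' u' κ u x z a c =>
      ∑' n : Site (d + 1), wilsonW₂ d ((8 * (N : ℝ) ^ 2)⁻¹ • wsym22 N) κ u κ' (translate (fine Lc M') u' n) x z a c)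
    {H₂ : Matrix (↥(pbox (fine Lc M')) × Fin (d + 1)) (↥(pbox (fine Lc M')) × Fin (d + 1)) ℝ}
    (hH₂ : H₂ = ((-2 : ℝ) * c) ^ 2 •
        ∑ b : ↥(pbox (fine Lc M')) × Fin (d + 1), ∑ b' : ↥(pbox (fine Lc M')) × Fin (d + 1), (h b * h b') •
          (perF (fine Lc M') (dper (fine Lc M') (W b'.2 (b'.1 : Site (d + 1)) b.2 (b.1 : Site (d + 1))))).submatrix
            (fun c : ↥(pbox (fine Lc M')) × Fin (d + 1) => ((c.1, Sum.inl c.2) : Idx (fine Lc M') (Fib d)))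
            (fun c : ↥(pbox (fine Lc M')) × Fin (d + 1) => ((c.1, Sum.inl c.2) : Idx (fine Lc M') (Fib d)))) :
    H₂ * Matrix.fromCols D₂ D₁ + (2 : ℝ) • (H₁ * W₁) + H₀ * W₂
      = c ^ 2 • Matrix.of (fun (v : ↥(pbox (fine Lc M')) × Fin (d + 1)) (e : γ₂ ⊕ γ₁) =>
          h v * H₀.mulVec h v
            * Sum.elim (fun t : γ₂ => tdelta M' (quo Lc ((v.1 : Site (d + 1)) + unitVec v.2)) (g₂ t))
                (fun s : γ₁ => tdelta (fine Lc M') ((v.1 : Site (d + 1)) + unitVec v.2) (g₁ s)) e) := by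
  classical
  -- entries of the ingredients
  have hH0 : ∀ v b : ↥(pbox (fine Lc M')) × Fin (d + 1),
      H₀ v b = perZ (fine Lc M') (bhKStepAt d ρ L 0) (v.1 : Site (d + 1)) (b.1 : Site (d + 1)) (Sum.inl v.2) (Sum.inl b.2) := fun v b => by
    rw [hH₀]; rfl
  have hW1 : ∀ (b' : ↥(pbox (fine Lc M')) × Fin (d + 1)) (e : γ₂ ⊕ γ₁),
      W₁ b' e = h b' * (-c * Sum.elim (fun t : γ₂ => tdelta M' (quo Lc ((b'.1 : Site (d + 1)) + unitVec b'.2)) (g₂ t))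
        (fun s : γ₁ => tdelta (fine Lc M') ((b'.1 : Site (d + 1)) + unitVec b'.2) (g₁ s)) e) := fun b' e => by
    rw [hW₁, Matrix.sum_apply]
    simp only [Matrix.smul_apply, Matrix.of_apply, smul_eq_mul, mul_ite, mul_zero]
    rw [Finset.sum_ite_eq]
    simp only [Finset.mem_univ, if_true]
  have hW2 : ∀ (b : ↥(pbox (fine Lc M')) × Fin (d + 1)) (e : γ₂ ⊕ γ₁),
      W₂ b e = (c * h b) ^ 2 * Sum.elim (fun t : γ₂ => tdelta M' (quo Lc ((b.1 : Site (d + 1)) + unitVec b.2)) (g₂ t))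
        (fun s : γ₁ => tdelta (fine Lc M') ((b.1 : Site (d + 1)) + unitVec b.2) (g₁ s)) e := fun b e => by
    rw [hW₂]; rfl
  have hH1 : ∀ v b' : ↥(pbox (fine Lc M')) × Fin (d + 1), H₁ v b' = (-2 * c) * ∑ b : ↥(pbox (fine Lc M')) × Fin (d + 1),
      h b * perZ (fine Lc M') (dper (fine Lc M') (wilsonA d b.2 (b.1 : Site (d + 1)))) (v.1 : Site (d + 1)) (b'.1 : Site (d + 1)) (Sum.inl v.2) (Sum.inl b'.2) :=
    fun v b' => by
    rw [hH₁, Matrix.smul_apply, Matrix.sum_apply, smul_eq_mul]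
    simp only [Matrix.smul_apply, Matrix.submatrix_apply, perF_apply, smul_eq_mul]
  have hWV : ∀ (κ' : Fin (d + 1)) (u' : Site (d + 1)), W κ' u' = fun κ u x z a c =>
      ∑' n : Site (d + 1), wilsonW₂ d ((8 * (N : ℝ) ^ 2)⁻¹ • wsym22 N) κ u κ' (translate (fine Lc M') u' n) x z a c := fun κ' u' => by rw [hW]
  have hind : ∀ b b' : ↥(pbox (fine Lc M')) × Fin (d + 1),
      (if (b.1 : Site (d + 1)) = (b'.1 : Site (d + 1)) ∧ b.2 = b'.2 then (1 : ℝ) else 0) = if b = b' then (1 : ℝ) else 0 := by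
    intro b b'
    by_cases hb : b = b'
    · rw [if_pos hb, if_pos ⟨by rw [hb], by rw [hb]⟩]
    · rw [if_neg hb, if_neg fun h' => hb (Prod.ext (Subtype.ext h'.1) h'.2)]
  -- the bi-member block against the two column families: §3 per pair of bonds
  have hVD₂ : ∀ (b b' v : ↥(pbox (fine Lc M')) × Fin (d + 1)) (t : γ₂),
      ((perF (fine Lc M') (dper (fine Lc M') (W b'.2 (b'.1 : Site (d + 1)) b.2 (b.1 : Site (d + 1))))).submatrix
            (fun c : ↥(pbox (fine Lc M')) × Fin (d + 1) => ((c.1, Sum.inl c.2) : Idx (fine Lc M') (Fib d)))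
            (fun c : ↥(pbox (fine Lc M')) × Fin (d + 1) => ((c.1, Sum.inl c.2) : Idx (fine Lc M') (Fib d))) * D₂) v t
        = -(1 / 2 : ℝ) * (tdelta M' (quo Lc ((b'.1 : Site (d + 1)) + unitVec b'.2)) (g₂ t)
              * perZ (fine Lc M') (dper (fine Lc M') (wilsonA d b.2 (b.1 : Site (d + 1)))) (v.1 : Site (d + 1)) (b'.1 : Site (d + 1)) (Sum.inl v.2) (Sum.inl b'.2)
            + tdelta M' (quo Lc ((b.1 : Site (d + 1)) + unitVec b.2)) (g₂ t)
              * perZ (fine Lc M') (dper (fine Lc M') (wilsonA d b'.2 (b'.1 : Site (d + 1)))) (v.1 : Site (d + 1)) (b.1 : Site (d + 1)) (Sum.inl v.2) (Sum.inl b.2))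
          - (1 / 4 : ℝ) * ((if b = b' then (1 : ℝ) else 0) * tdelta M' (quo Lc ((b.1 : Site (d + 1)) + unitVec b.2)) (g₂ t)
              * perZ (fine Lc M') (bhKStepAt d ρ L 0) (v.1 : Site (d + 1)) (b.1 : Site (d + 1)) (Sum.inl v.2) (Sum.inl b.2))
          + (1 / 8 : ℝ) * tdelta M' (quo Lc ((v.1 : Site (d + 1)) + unitVec v.2)) (g₂ t)
              * ((if v = b' then (1 : ℝ) else 0) * perZ (fine Lc M') (bhKStepAt d ρ L 0) (v.1 : Site (d + 1)) (b.1 : Site (d + 1)) (Sum.inl v.2) (Sum.inl b.2)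
                + (if v = b then (1 : ℝ) else 0) * perZ (fine Lc M') (bhKStepAt d ρ L 0) (v.1 : Site (d + 1)) (b'.1 : Site (d + 1)) (Sum.inl v.2) (Sum.inl b'.2)) := by
    intro b b' v t
    rw [hD₂, Matrix.mul_apply, Fintype.sum_prod_type]
    simp only [Matrix.submatrix_apply, perF_apply]
    rw [sum_perZ_dper_wilsonT2per_mul_tgradBlock M' Lc hN b'.2 b'.1.2 (hWV b'.2 b'.1) ρ L b.2 b.1.2 v.1.2 v.2 (g₂ t)]
    simp only [hind]
  have hVD₁ : ∀ (b b' v : ↥(pbox (fine Lc M')) × Fin (d + 1)) (s : γ₁),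
      ((perF (fine Lc M') (dper (fine Lc M') (W b'.2 (b'.1 : Site (d + 1)) b.2 (b.1 : Site (d + 1))))).submatrix
            (fun c : ↥(pbox (fine Lc M')) × Fin (d + 1) => ((c.1, Sum.inl c.2) : Idx (fine Lc M') (Fib d)))
            (fun c : ↥(pbox (fine Lc M')) × Fin (d + 1) => ((c.1, Sum.inl c.2) : Idx (fine Lc M') (Fib d))) * D₁) v s
        = -(1 / 2 : ℝ) * (tdelta (fine Lc M') ((b'.1 : Site (d + 1)) + unitVec b'.2) (g₁ s)
              * perZ (fine Lc M') (dper (fine Lc M') (wilsonA d b.2 (b.1 : Site (d + 1)))) (v.1 : Site (d + 1)) (b'.1 : Site (d + 1)) (Sum.inl v.2) (Sum.inl b'.2)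
            + tdelta (fine Lc M') ((b.1 : Site (d + 1)) + unitVec b.2) (g₁ s)
              * perZ (fine Lc M') (dper (fine Lc M') (wilsonA d b'.2 (b'.1 : Site (d + 1)))) (v.1 : Site (d + 1)) (b.1 : Site (d + 1)) (Sum.inl v.2) (Sum.inl b.2))
          - (1 / 4 : ℝ) * ((if b = b' then (1 : ℝ) else 0) * tdelta (fine Lc M') ((b.1 : Site (d + 1)) + unitVec b.2) (g₁ s)
              * perZ (fine Lc M') (bhKStepAt d ρ L 0) (v.1 : Site (d + 1)) (b.1 : Site (d + 1)) (Sum.inl v.2) (Sum.inl b.2))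
          + (1 / 8 : ℝ) * tdelta (fine Lc M') ((v.1 : Site (d + 1)) + unitVec v.2) (g₁ s)
              * ((if v = b' then (1 : ℝ) else 0) * perZ (fine Lc M') (bhKStepAt d ρ L 0) (v.1 : Site (d + 1)) (b.1 : Site (d + 1)) (Sum.inl v.2) (Sum.inl b.2)
                + (if v = b then (1 : ℝ) else 0) * perZ (fine Lc M') (bhKStepAt d ρ L 0) (v.1 : Site (d + 1)) (b'.1 : Site (d + 1)) (Sum.inl v.2) (Sum.inl b'.2)) := by
    intro b b' v s
    rw [hD₁, Matrix.mul_apply, Fintype.sum_prod_type]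
    simp only [Matrix.submatrix_apply, perF_apply]
    rw [sum_perZ_dper_wilsonT2per_mul_tgrad (fine Lc M') hN b'.2 b'.1.2 (hWV b'.2 b'.1) ρ L b.2 b.1.2 v.1.2 v.2 (g₁ s)]
    simp only [hind]
  -- the order-two product, entrywise, as a double bond sum
  have hH2D₂ : ∀ (v : ↥(pbox (fine Lc M')) × Fin (d + 1)) (t : γ₂),
      (H₂ * D₂) v t = (-2 * c) ^ 2 * ∑ b : ↥(pbox (fine Lc M')) × Fin (d + 1), ∑ b' : ↥(pbox (fine Lc M')) × Fin (d + 1), h b * h b' *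
        ((perF (fine Lc M') (dper (fine Lc M') (W b'.2 (b'.1 : Site (d + 1)) b.2 (b.1 : Site (d + 1))))).submatrix
            (fun c : ↥(pbox (fine Lc M')) × Fin (d + 1) => ((c.1, Sum.inl c.2) : Idx (fine Lc M') (Fib d)))
            (fun c : ↥(pbox (fine Lc M')) × Fin (d + 1) => ((c.1, Sum.inl c.2) : Idx (fine Lc M') (Fib d))) * D₂) v t := by
    intro v t
    rw [hH₂, Matrix.smul_mul, Matrix.sum_mul, Matrix.smul_apply, Matrix.sum_apply, smul_eq_mul]
    refine congrArg _ (Finset.sum_congr rfl fun b _ => ?_)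
    rw [Matrix.sum_mul, Matrix.sum_apply]
    refine Finset.sum_congr rfl fun b' _ => ?_
    rw [Matrix.smul_mul, Matrix.smul_apply, smul_eq_mul]
  have hH2D₁ : ∀ (v : ↥(pbox (fine Lc M')) × Fin (d + 1)) (s : γ₁),
      (H₂ * D₁) v s = (-2 * c) ^ 2 * ∑ b : ↥(pbox (fine Lc M')) × Fin (d + 1), ∑ b' : ↥(pbox (fine Lc M')) × Fin (d + 1), h b * h b' *
        ((perF (fine Lc M') (dper (fine Lc M') (W b'.2 (b'.1 : Site (d + 1)) b.2 (b.1 : Site (d + 1))))).submatrix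
            (fun c : ↥(pbox (fine Lc M')) × Fin (d + 1) => ((c.1, Sum.inl c.2) : Idx (fine Lc M') (Fib d)))
            (fun c : ↥(pbox (fine Lc M')) × Fin (d + 1) => ((c.1, Sum.inl c.2) : Idx (fine Lc M') (Fib d))) * D₁) v s := by
    intro v s
    rw [hH₂, Matrix.smul_mul, Matrix.sum_mul, Matrix.smul_apply, Matrix.sum_apply, smul_eq_mul]
    refine congrArg _ (Finset.sum_congr rfl fun b _ => ?_)
    rw [Matrix.sum_mul, Matrix.sum_apply]
    refine Finset.sum_congr rfl fun b' _ => ?_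
    rw [Matrix.smul_mul, Matrix.smul_apply, smul_eq_mul]
  rw [Matrix.mul_fromCols]
  ext v e
  rw [Matrix.add_apply, Matrix.add_apply, Matrix.smul_apply, Matrix.smul_apply, Matrix.of_apply, smul_eq_mul, smul_eq_mul,
    Matrix.mul_apply, Matrix.mul_apply]
  simp only [hW1, hW2, hH1, Matrix.mulVec, dotProduct, hH0]
  cases e with
  | inl t =>
      rw [Matrix.fromCols_apply_inl, hH2D₂ v t]
      simp only [hVD₂, Sum.elim_inl]
      exact a2_row_algebra c h (fun b => tdelta M' (quo Lc ((b.1 : Site (d + 1)) + unitVec b.2)) (g₂ t))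
        (fun b => perZ (fine Lc M') (bhKStepAt d ρ L 0) (v.1 : Site (d + 1)) (b.1 : Site (d + 1)) (Sum.inl v.2) (Sum.inl b.2))
        (fun b b' => perZ (fine Lc M') (dper (fine Lc M') (wilsonA d b.2 (b.1 : Site (d + 1)))) (v.1 : Site (d + 1)) (b'.1 : Site (d + 1)) (Sum.inl v.2) (Sum.inl b'.2)) v
  | inr s =>
      rw [Matrix.fromCols_apply_inr, hH2D₁ v s]
      simp only [hVD₁, Sum.elim_inr]
      exact a2_row_algebra c h (fun b => tdelta (fine Lc M') ((b.1 : Site (d + 1)) + unitVec b.2) (g₁ s))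
        (fun b => perZ (fine Lc M') (bhKStepAt d ρ L 0) (v.1 : Site (d + 1)) (b.1 : Site (d + 1)) (Sum.inl v.2) (Sum.inl b.2))
        (fun b b' => perZ (fine Lc M') (dper (fine Lc M') (wilsonA d b.2 (b.1 : Site (d + 1)))) (v.1 : Site (d + 1)) (b'.1 : Site (d + 1)) (Sum.inl v.2) (Sum.inl b'.2)) v

end DoorRow

end Summit.QuantumFields.BalabanUV.Beta.FP.PeriodisedWardOrderTwoWilson

end
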